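import Mathlib.LinearAlgebra.Matrix.NonsingularInverse
import Summits.HodgeConjecture.HodgeConjecture.Theorems.R90S6SpeiserDescent
import HarnessLib

/-!
# Hilbert's Theorem 90 for `GL_n`: `H¹(Γ, GL_n(L)) = 1` (Speiser), all characteristics

R90-TF, section S6 (Rogawski Ch. 14.1–14.5, stable trace formula), WAVE 7 card **W7-g**
(DAG row E1.4.3.2.1 «Hilbert 90 for `GL_n`, field level: `H¹(Gal(L_w/L⁺_v), GL_n(L_w)) = 1`»,
and the residue-field input of E1.4.3.2.2 «integral Hilbert 90, unramified»), helper lane for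
`stmt-HodgeConjecture-24833`.

Let a finite group `Γ` act faithfully by ring automorphisms on a field `L` (e.g.
`Γ = L ≃ₐ[K] L` for `L/K` finite Galois, Mathlib `AlgEquiv.applyMulSemiringAction`, or the
Galois group of a finite field generated by Frobenius), and write `s(M) = M.map (s • ·)` for the
entrywise action on matrices. A **`1`-cocycle** of `Γ` in `GL_n(L)` is a family of invertible
matrices `c_s` with `c_{st} = c_s · s(c_t)`. **Theorem** (`exists_isUnit_forall_mul_map_smul_eq`):
every `1`-cocycle is a coboundary, `c_s · s(a) = a` for an invertible `a`, i.e.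
`c_s = a · s(a)⁻¹` — `H¹(Γ, GL_n(L)) = 1` (Serre, *Local Fields*, Ch. X, §1, Prop. 3; Speiser
1919). No hypothesis on the characteristic or on the size of `L^Γ`: this covers the finite
residue extensions `𝔽_{q²}/𝔽_q` where the tree's `hilbert90_algebra` (which needs infinitely many
invariant scalars) does not apply; for `n = 1` it is Mathlib's
`groupCohomology.isMulCoboundary₁_of_isMulCocycle₁_of_aut_to_units`.

Proof (Serre, loc. cit.): the twisted action `ρ_s(v) = c_s *ᵥ s(v)` on `L^n` is an additive,
semilinear action of `Γ` (the cocycle identity is exactly `ρ_{st} = ρ_s ∘ ρ_t`); by the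
fixed-basis form of Speiser descent (`R90.S6.exists_basis_forall_fixed_of_semilinear`, from the
tree's `Literature.RingTheory.GaloisAlgebras.span_fixedPoints_eq_top`) `L^n` has an `L`-basis of
`ρ`-fixed vectors; the matrix `a` with these vectors as columns is invertible
(`Matrix.linearIndependent_cols_iff_isUnit`) and `ρ_s(a_j) = a_j` for every column reads
`c_s · s(a) = a`.

## References
* J.-P. Serre, *Local Fields*, GTM 67 (1979), Ch. X, §1, Prop. 3.
* A. Speiser, *Zahlentheoretische Sätze aus der Gruppentheorie*, Math. Z. 5 (1919), 1–6.
-/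

set_option autoImplicit false
set_option linter.dupNamespace false

namespace Summit.HodgeConjecture.HodgeConjecture.R90.S6

open Matrix

/-- **Hilbert's Theorem 90 for `GL_n` (`H¹(Γ, GL_n(L)) = 1`, Speiser).** Let the finite group
`Γ` act faithfully by ring automorphisms on the field `L`, and let `c : Γ → M_n(L)` be a
`1`-cocycle of invertible matrices for the entrywise action, `c (s * t) = c s * s(c t)` with
`s(M) = M.map (s • ·)`. Then there is an invertible matrix `a` with `c s * s(a) = a` for all
`s ∈ Γ` (so `c s = a * s(a)⁻¹`: every cocycle is a coboundary). Valid in every characteristic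
and for every finite `Γ ↪ Aut(L)` (Serre, *Local Fields*, Ch. X, §1, Prop. 3), in particular for
`Γ = L ≃ₐ[K] L` (`s • x = s x`, `AlgEquiv.smul_def`) and for finite fields. Proof: apply the
fixed-basis form of Speiser descent `exists_basis_forall_fixed_of_semilinear` to the twisted
semilinear action `v ↦ c s *ᵥ s(v)` on `n → L` and take for `a` the matrix whose columns are the
fixed basis. -/
theorem exists_isUnit_forall_mul_map_smul_eq {Γ L n : Type*} [Group Γ] [Fintype Γ] [Field L]
    [MulSemiringAction Γ L] [FaithfulSMul Γ L] [Fintype n] [DecidableEq n]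
    (c : Γ → Matrix n n L) (hcu : ∀ s, IsUnit (c s))
    (hc : ∀ s t, c (s * t) = c s * (c t).map (s • ·)) :
    ∃ a : Matrix n n L, IsUnit a ∧ ∀ s, c s * a.map (s • ·) = a := by
  classical
  -- (1) `c 1 = 1`, from `c 1 = c 1 * c 1`
  have hc1 : c 1 = 1 := by
    have hmap : (c 1).map ((1 : Γ) • ·) = c 1 := by
      ext i j
      exact one_smul Γ (c 1 i j)
    have h := hc 1 1
    rw [mul_one, hmap] at h
    have h2 : c 1 * c 1 = c 1 * 1 := by rw [mul_one]; exact h.symm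
    exact (hcu 1).mul_left_cancel h2
  -- (2) the entrywise action commutes with `mulVec`: `s(M v) = s(M) s(v)`
  have hsmul_mulVec : ∀ (s : Γ) (M : Matrix n n L) (v : n → L),
      s • (M *ᵥ v) = M.map (s • ·) *ᵥ (s • v) := fun s M v => by
    ext i
    simp only [Pi.smul_apply, Matrix.mulVec, dotProduct, Finset.smul_sum, smul_mul',
      Matrix.map_apply]
  -- (3) the twisted semilinear action `ρ_s v = c_s *ᵥ s(v)` on `n → L`
  let ρ : Γ →* AddMonoid.End (n → L) :=
    { toFun := fun s => (Matrix.mulVecLin (c s)).toAddMonoidHom.comp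
        (DistribMulAction.toAddMonoidEnd Γ (n → L) s)
      map_one' := by
        ext v i
        show (c 1 *ᵥ ((1 : Γ) • v)) i = v i
        rw [hc1, one_smul, Matrix.one_mulVec]
      map_mul' := fun s t => by
        ext v i
        show (c (s * t) *ᵥ ((s * t) • v)) i = (c s *ᵥ (s • (c t *ᵥ (t • v)))) i
        rw [hc, mul_smul, ← Matrix.mulVec_mulVec, hsmul_mulVec] }
  have hρapply : ∀ (s : Γ) (v : n → L), ρ s v = c s *ᵥ (s • v) := fun _ _ => rfl
  have hρ : ∀ (s : Γ) (e : L) (v : n → L), ρ s (e • v) = (s • e) • ρ s v := fun s e v => by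
    have hsev : s • (e • v) = (s • e) • (s • v) := by
      ext i
      simp only [Pi.smul_apply, smul_eq_mul, smul_mul']
    rw [hρapply, hρapply, hsev, Matrix.mulVec_smul]
  -- (4) a basis of `n → L` made of `ρ`-fixed vectors (Speiser descent), re-indexed by `n`
  obtain ⟨b, hb⟩ := exists_basis_forall_fixed_of_semilinear ρ hρ
  let e : Fin (Module.finrank L (n → L)) ≃ n := b.indexEquiv (Pi.basisFun L n)
  let b' : Module.Basis n L (n → L) := b.reindex e
  have hb' : ∀ j s, ρ s (b' j) = b' j := fun j s => by
    simp only [b', Module.Basis.reindex_apply]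
    exact hb (e.symm j) s
  -- (5) the matrix `a` with the fixed basis vectors as columns
  let a : Matrix n n L := Matrix.of fun i j => b' j i
  have hcol : a.col = ⇑b' := rfl
  have ha : IsUnit a := Matrix.linearIndependent_cols_iff_isUnit.mp (hcol ▸ b'.linearIndependent)
  refine ⟨a, ha, fun s => ?_⟩
  ext i j
  have h := congr_fun (hb' j s) i
  rw [hρapply] at h
  simp only [Matrix.mulVec, dotProduct, Pi.smul_apply] at h
  simp only [Matrix.mul_apply, Matrix.map_apply, a, Matrix.of_apply]
  exact h

end Summit.HodgeConjecture.HodgeConjecture.R90.S6
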